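import Summits.BirchSwinnertonDyer.BirchSwinnertonDyer.Theorems.ResidualThetaTransportAtTwoUnramifiedRestriction
import Summits.BirchSwinnertonDyer.BirchSwinnertonDyer.Theorems.ResidualThetaTransportAtTwoResidualEvenSubgroupLocal
import Summits.BirchSwinnertonDyer.BirchSwinnertonDyer.Theorems.ThetaPartnerAtTwoSignedTransportAtTwoResidualKummer
import Literature.NumberTheory.EllipticCurves.GreenbergVatsal2000.ResidualSelmerGroups
import Literature.NumberTheory.EllipticCurves.GreenbergSelmerNewform
import Literature.NumberTheory.EllipticCurves.NewformPadicIntegralModel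
import HarnessLib

/-!
# The unramified condition along an equivariant push-forward `i_* : H¹(H, N) → H¹(H, M)`, and along the residual
# isomorphism `j_*` of the θ-line (crux (R≥)ᵖ, stub `stub_transport` v2, unramified clause of step (e))

Route `ResidualThetaTransportAtTwo` (RTT), crux (R≥)ᵖ `ResidualThetaCountLowerPureAtTwo` (stmt-BirchSwinnertonDyer-26074),
line «bt26-lambda» v2; seat `prover-bsd-wall-rtt-p2` g12 (`--supports`, closes nothing). HONEST FRAMING: THEOREMS ONLY (no
definition, no named fact, no instance, no `sorry`); Galois-cohomological plumbing; nothing about any Selmer count or the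
conditions at `2` / `∞`; BSD is not proved by any of this.

WHAT.
* §1 (any number field `K`, `H ≤ Γ_K`, discrete `Γ_K`-modules `N → M` along an equivariant `i`): `pushH1_mem_unramifiedKer` — `i_*`
  PRESERVES the unramified condition at `v` (always); `mem_unramifiedKer_of_pushH1_mem` — and REFLECTS it when `i` is injective and
  the inertia group `H ⊓ I_v` acts trivially on `M`; `conjH1_pushH1` — `conj_σ ∘ i_* = i_* ∘ conj_σ`; `pushH1_mem_unramifiedOutside`,
  `mem_unramifiedOutside_iff_pushH1_mem` — the same for `GreenbergVatsal2000.unramifiedOutside H · p S₀` (all conjugates, all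
  `v ∉ S₀`, `v ∤ p`).
* §2 (the θ-line): for the datum `ρ : Γ_ℚ → GL₂(𝒪)` unramified at every `v` with `ℓ_v ∤ 2M` and `S₀ ⊇ primes(M)`, the inertia group
  `GreenbergSelmer.inertia v` (`v ∉ S₀`, `v ∤ 2`) acts trivially on `A_g = Cofree ρ E` (`smul_cofree_eq_of_mem_inertia`), so for the
  residual isomorphism `j : ((W[2^∞])[2])^f →+ A_g` of `stub_residualIso`:
  **`mem_unramifiedOutside_iff_pushH1_residual_mem`** — `x` is unramified outside `S₀` iff `j_* x` is.

References: [GreenbergVatsal2000] §2 pp. 16–17, 23; [SerreGaloisCohomology1997] I.§2.4, I.§5.1; [SilvermanAEC2009] VII.4.1.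
-/

set_option autoImplicit false
-- the Theorems namespace of this sub repeats the summit name by design (D-0017 nested layout)
set_option linter.dupNamespace false

noncomputable section

open scoped AddSubgroup
open WeierstrassCurve NumberField Field IsDedekindDomain Literature Literature.NumberTheory.EllipticCurves
  Literature.NumberTheory.EllipticCurves.GreenbergSelmer Literature.NumberTheory.EllipticCurves.GreenbergVatsal2000
  Literature.NumberTheory.GaloisRepresentations Summit.BirchSwinnertonDyer.BirchSwinnertonDyer.Theorems.SignedTransportAtTwo
  Summit.BirchSwinnertonDyer.BirchSwinnertonDyer.Theorems.ResidualLayer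

namespace Summit.BirchSwinnertonDyer.BirchSwinnertonDyer.Theorems.ThetaTransport

universe u

/-! ### §1. `unramifiedKer` / `unramifiedOutside` along `i_*` -/

section Generic

variable {K : Type u} [Field K] [NumberField K] {H : Subgroup (absoluteGaloisGroup K)}
  {M : Type u} [AddCommGroup M] [DistribMulAction (absoluteGaloisGroup K) M] [TopologicalSpace M] [DiscreteTopology M]
  {N : Type u} [AddCommGroup N] [DistribMulAction (absoluteGaloisGroup K) N] [TopologicalSpace N] [DiscreteTopology N]
  (i : N →+ M) (hi : ∀ (g : absoluteGaloisGroup K) (x : N), i (g • x) = g • i x)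

/-- **`i_*` preserves the unramified condition at `v`**: a coboundary witness `n` for `z` on `H ⊓ I_v` gives the witness `i n` for
`i ∘ z`. [cite: GreenbergVatsal2000, §2 p. 17] [cite: SerreGaloisCohomology1997, I.§2.4] -/
theorem pushH1_mem_unramifiedKer [H.Normal] (v : HeightOneSpectrum (𝓞 K)) {x : subgroupH1 H N}
    (hx : x ∈ unramifiedKer H N v) : pushH1 H i hi x ∈ unramifiedKer H M v := by
  obtain ⟨z, rfl⟩ := oneCocycleClass_surjective _ x
  rw [oneCocycleClass_mem_unramifiedKer_iff] at hx
  obtain ⟨n, hn⟩ := hx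
  change resH1Hom (ContinuousMonoidHom.id H) i (fun h x ↦ hi h x) (oneCocycleClass _ z) ∈ _
  rw [SignedTransportAtTwo.resH1Hom_id_oneCocycleClass, oneCocycleClass_mem_unramifiedKer_iff]
  refine ⟨i n, fun y ↦ ?_⟩
  rw [contOneCocycles.pullback_apply]
  change i (z.1 (inertiaInToH H v y)) = y • i n - i n
  rw [hn y, map_sub, Subgroup.smul_def, Subgroup.smul_def, hi]
  rfl

/-- **`i_*` reflects the unramified condition at `v` when `i` is injective and `H ⊓ I_v` acts trivially on `M`** (then also on `N`,
and an `N`-cocycle whose push-forward vanishes on `H ⊓ I_v` vanishes there). [cite: GreenbergVatsal2000, §2 p. 17] -/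
theorem mem_unramifiedKer_of_pushH1_mem [H.Normal] (hinj : Function.Injective i) (v : HeightOneSpectrum (𝓞 K))
    (htriv : ∀ (y : inertiaIn H v) (m : M), ((y : decomp (K := K) v) : absoluteGaloisGroup K) • m = m)
    {x : subgroupH1 H N} (hx : pushH1 H i hi x ∈ unramifiedKer H M v) : x ∈ unramifiedKer H N v := by
  obtain ⟨z, rfl⟩ := oneCocycleClass_surjective _ x
  change resH1Hom (ContinuousMonoidHom.id H) i (fun h x ↦ hi h x) (oneCocycleClass _ z) ∈ _ at hx
  rw [SignedTransportAtTwo.resH1Hom_id_oneCocycleClass, oneCocycleClass_mem_unramifiedKer_iff] at hx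
  obtain ⟨m, hm⟩ := hx
  rw [oneCocycleClass_mem_unramifiedKer_iff]
  refine ⟨0, fun y ↦ hinj ?_⟩
  have e := hm y
  rw [contOneCocycles.pullback_apply] at e
  change i (z.1 (inertiaInToH H v y)) = y • m - m at e
  have hy : (y • m : M) = m := htriv y m
  rw [hy, sub_self] at e
  rw [e, smul_zero, sub_zero, map_zero]

omit [NumberField K] in
/-- **`conj_σ ∘ i_* = i_* ∘ conj_σ`** (both induced by the compatible pair `(h ↦ σ⁻¹hσ, n ↦ σ • i n = i (σ • n))`).
[cite: NeukirchSchmidtWingberg2008, I.§5] -/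
theorem conjH1_pushH1 [H.Normal] (σ : absoluteGaloisGroup K) (x : subgroupH1 H N) :
    conjH1 H M σ (pushH1 H i hi x) = pushH1 H i hi (conjH1 H N σ x) := by
  change ((conjH1 H M σ).comp (resH1Hom (ContinuousMonoidHom.id H) i fun h x ↦ hi h x)) x =
    ((resH1Hom (ContinuousMonoidHom.id H) i fun h x ↦ hi h x).comp (conjH1 H N σ)) x
  congr 1
  rw [Literature.NumberTheory.EllipticCurves.conjH1, Literature.NumberTheory.EllipticCurves.conjH1, resH1Hom_comp,
    resH1Hom_comp]
  exact resH1Hom_congr (by ext; rfl) (by ext n; simp [hi]) _ _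

variable (p : ℕ) (S₀ : Set (HeightOneSpectrum (𝓞 K)))

/-- **`i_*` maps `unramifiedOutside H N p S₀` into `unramifiedOutside H M p S₀`.** [cite: GreenbergVatsal2000, §2 pp. 16, 23] -/
theorem pushH1_mem_unramifiedOutside [H.Normal] {x : subgroupH1 H N} (hx : x ∈ unramifiedOutside H N p S₀) :
    pushH1 H i hi x ∈ unramifiedOutside H M p S₀ := by
  rw [mem_unramifiedOutside_iff] at hx ⊢
  intro v hv hpv σ
  rw [conjH1_pushH1]
  exact pushH1_mem_unramifiedKer i hi v (hx v hv hpv σ)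

/-- **`x ∈ unramifiedOutside H N p S₀ ↔ i_* x ∈ unramifiedOutside H M p S₀`** when `i` is injective and, for every `v ∉ S₀` with
`v ∤ p`, the inertia group `H ⊓ I_v` acts trivially on `M`. [cite: GreenbergVatsal2000, §2 pp. 16–17, 23] -/
theorem mem_unramifiedOutside_iff_pushH1_mem [H.Normal] (hinj : Function.Injective i)
    (htriv : ∀ v : HeightOneSpectrum (𝓞 K), v ∉ S₀ → ((p : ℕ) : 𝓞 K) ∉ v.asIdeal →
      ∀ (y : inertiaIn H v) (m : M), ((y : decomp (K := K) v) : absoluteGaloisGroup K) • m = m)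
    (x : subgroupH1 H N) :
    x ∈ unramifiedOutside H N p S₀ ↔ pushH1 H i hi x ∈ unramifiedOutside H M p S₀ := by
  refine ⟨pushH1_mem_unramifiedOutside i hi p S₀, fun hx ↦ ?_⟩
  rw [mem_unramifiedOutside_iff] at hx ⊢
  intro v hv hpv σ
  refine mem_unramifiedKer_of_pushH1_mem i hi hinj v (htriv v hv hpv) ?_
  rw [← conjH1_pushH1]
  exact hx v hv hpv σ

end Generic

/-! ### §2. The θ-line: inertia off `S₀ ∪ {2}` acts trivially on `A_g`; the unramified clause along `j_*` -/

section Habitat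

variable (W : WeierstrassCurve ℚ) [W.IsElliptic] [W.IsGloballyMinimal] {M : ℕ}
  {g : CuspForm (CongruenceSubgroup.Gamma0 M) 2} {ι : ModularForms.coeffField g →+* PadicAlgCl 2}

omit [W.IsElliptic] [W.IsGloballyMinimal] in
/-- **Inertia at `v` with `ℓ_v ∤ 2M` acts trivially on `A_g`** for the θ-line datum `ρ` (unramified there): `GreenbergSelmer.inertia v` is the
inertia group of the tree's prime `adicCompletionPrime ℚ v` above `v`, on which `ρ` is `1`. [cite: SilvermanAEC2009, Prop. VII.4.1(a)]
[cite: NeukirchANT1999, Ch. II §9 Prop. (9.6)] -/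
theorem smul_cofree_eq_of_mem_inertia (ρ : FramedGaloisRep ℚ ↥(padicCoeffIntegers (Set.range ι)) 2)
    {v : HeightOneSpectrum (𝓞 ℚ)} (hρv : FramedGaloisRep.IsUnramifiedAt v ρ)
    {σ : absoluteGaloisGroup ℚ} (hσ : σ ∈ inertia v) (a : Cofree ρ ↥(padicCoeffField (Set.range ι))) : σ • a = a := by
  obtain ⟨τ, hτ, rfl⟩ := hσ
  have hτ' : absGaloisRestrict ℚ (v.adicCompletion ℚ) τ ∈ (adicCompletionPrime ℚ v).inertia (absoluteGaloisGroup ℚ) := by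
    rw [inertia_adicCompletionPrime_eq_map_absInertia]
    exact Subgroup.mem_map_of_mem _ hτ
  have h1 : ρ (absGaloisRestrict ℚ (v.adicCompletion ℚ) τ) = 1 :=
    hρv _ (adicCompletionPrime_mem_primesAbove ℚ v) _ hτ'
  obtain ⟨x, rfl⟩ := cofreeMk_surjective _ ρ a
  change absGaloisRestrict ℚ (v.adicCompletion ℚ) τ • cofreeMk _ ρ x = cofreeMk _ ρ x
  rw [smul_cofreeMk, fracRepresentation_apply_apply, h1, Units.val_one, Matrix.map_one _ (map_zero _) (map_one _),
    Matrix.one_mulVec]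

omit [W.IsElliptic] [W.IsGloballyMinimal] in
/-- **The unramified clause transports along `j_*`**: on the θ-line (`ρ` unramified at every `v` with `ℓ_v ∤ 2M`, `S₀ ⊇ primes(M)`),
for the residual isomorphism `j : ((W[2^∞])[2])^f →+ A_g` (injective, `Γ_ℚ`-equivariant) and every `ℤ₂`-extension `κ`:
`x ∈ unramifiedOutside Γ_{ℚ_∞} ((W[2^∞])[2])^f 2 S₀ ↔ j_* x ∈ unramifiedOutside Γ_{ℚ_∞} A_g 2 S₀`.
[cite: GreenbergVatsal2000, §2 pp. 16–17, 23] -/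
theorem mem_unramifiedOutside_iff_pushH1_residual_mem [NeZero M] (κ : ZpExtension ℚ 2)
    (S₀ : Finset (HeightOneSpectrum (𝓞 ℚ)))
    (hMS : ∀ v : HeightOneSpectrum (𝓞 ℚ), Rat.HeightOneSpectrum.natGenerator v ∣ M → v ∈ S₀)
    (ρ : FramedGaloisRep ℚ ↥(padicCoeffIntegers (Set.range ι)) 2)
    (hρ : ∀ v : HeightOneSpectrum (𝓞 ℚ), ¬ Rat.HeightOneSpectrum.natGenerator v ∣ 2 * M →
      FramedGaloisRep.IsUnramifiedAt v ρ)
    {f : ℕ} (j : (Fin f → ↥(AddSubgroup.torsionBy ↥(W.geomPrimaryTorsion 2) (2 : ℤ))) →+ Cofree ρ ↥(padicCoeffField (Set.range ι)))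
    (hjinj : Function.Injective j)
    (hjsmul : ∀ (σ : absoluteGaloisGroup ℚ) (x : Fin f → ↥(AddSubgroup.torsionBy ↥(W.geomPrimaryTorsion 2) (2 : ℤ))),
      j (σ • x) = σ • j x)
    (x : subgroupH1 κ.kerSubgroup (Fin f → ↥(AddSubgroup.torsionBy ↥(W.geomPrimaryTorsion 2) (2 : ℤ)))) :
    x ∈ unramifiedOutside κ.kerSubgroup (Fin f → ↥(AddSubgroup.torsionBy ↥(W.geomPrimaryTorsion 2) (2 : ℤ))) 2
        (↑S₀ : Set (HeightOneSpectrum (𝓞 ℚ))) ↔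
      pushH1 κ.kerSubgroup j hjsmul x ∈ unramifiedOutside κ.kerSubgroup (Cofree ρ ↥(padicCoeffField (Set.range ι))) 2
        (↑S₀ : Set (HeightOneSpectrum (𝓞 ℚ))) := by
  refine mem_unramifiedOutside_iff_pushH1_mem j hjsmul 2 _ hjinj (fun v hv h2v y a ↦ ?_) x
  -- `ℓ_v ∤ 2M`
  have hℓ : (Rat.HeightOneSpectrum.natGenerator v).Prime := Rat.HeightOneSpectrum.prime_natGenerator v
  have hvM : ¬ Rat.HeightOneSpectrum.natGenerator v ∣ M := fun h ↦ hv (Finset.mem_coe.mpr (hMS v h))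
  have hv2 : Rat.HeightOneSpectrum.natGenerator v ≠ 2 := by
    intro h
    apply h2v
    have := Rat.HeightOneSpectrum.natCast_natGenerator_mem v
    rw [h] at this
    exact this
  have h2M : ¬ Rat.HeightOneSpectrum.natGenerator v ∣ 2 * M := by
    intro h
    rcases (Nat.Prime.dvd_mul hℓ).mp h with h2 | hM'
    · exact hv2 ((Nat.prime_dvd_prime_iff_eq hℓ Nat.prime_two).mp h2)
    · exact hvM hM'
  exact smul_cofree_eq_of_mem_inertia ρ (hρ v h2M) ((mem_inertiaIn_iff _ v y).1 y.2).2 a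

end Habitat

end Summit.BirchSwinnertonDyer.BirchSwinnertonDyer.Theorems.ThetaTransport

end
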